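import Summits.AnomalousDissipation.AnomalousDissipation.Theorems.SawtoothPulseCascadeK1LocalisedCascadeSpectralCommutator

/-!
# K1loc, line `Spectral` / SeqCone — helper: HIGHER-ORDER SYMBOLIC EXPANSION OF `m(D)(Θ·F)` (T1/T2 brick)

Helper file of the prover lane on the crux `K1LocalisedCascade` (stmt-AnomalousDissipation-19491), route
`SawtoothPulseCascade` (memo v4 §3 and NOTES "T2 FINDING").  g0's commutator estimate `sqrt_tsum_sq_commutator_le`
(`…SpectralCommutator`) is FIRST order: `‖[m(D), Θ]F‖ ≤ (Σ_q ω(q)|𝓕Θ(q)|) ‖F‖`, and the `ω`-moment of the strip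
multipliers grows like (number of strips) × (inverse zone width), which beats the symbol's Lipschitz gain on part of the
parameter box (`2ρ_N² > γ²`).  The cure is the symbolic calculus to order `r`: with "derivative multipliers" `Θ_α`
(`𝓕Θ_α(q) = (2πi q_j)^α 𝓕Θ(q)`, i.e. `Θ_α = ∂_j^α Θ` for a multiplier read off `x_j`) and "derivative symbols" `m_α`,
`m(k) 𝓕(ΘF)(k) = Σ_{α<r} 𝓕(Θ_α · m_α(D)F)(k) + R(k)`,  `‖R‖_{ℓ²} ≤ L (Σ_q ρ(q)|𝓕Θ(q)|) ‖F‖`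
whenever `|m(k) − Σ_{α<r} (2πi q_j)^α m_α(k−q)| ≤ L ρ(q)` on the spectrum of `Θ` (a discrete Taylor remainder, supplied by
the user for his smooth symbol).  The lower-order terms cost `‖Θ_α‖_∞ ‖m_α(D)F‖` — sup norms, with NO strip-count factor.
Results: `sqrt_tsum_sq_kernel_le` (the Young-type bound for a general kernel), `symbol_mul_product_expansion` (the
identity), `sqrt_tsum_symbol_sq_mul_le_of_expansion` (the energy bound).  No definitions; no statement about the stub.
[cite: Grafakos2014, Prop. 3.1.2 (5) (coefficients of products are lattice convolutions) and Prop. 3.2.7 (3) (Parseval)]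
[problem: turb]
-/

-- `Summit.<Summit>.<Problem>`: single-conjunct summit, the duplicate namespace segment is deliberate.
set_option linter.dupNamespace false

noncomputable section

namespace Summit.AnomalousDissipation.AnomalousDissipation.Theorems.SawtoothPulseCascade.K1Slot

open MeasureTheory Set Filter Topology UnitAddTorus Complex
open scoped ComplexConjugate
open Literature.Analysis Literature.Analysis.FunctionSpaces Literature.Analysis.FluidPDE
open Literature.Analysis.FunctionSpaces.Torus
open Literature.Analysis.FluidPDE.ScalarFourier (lconv lconv_apply)
open Summit.AnomalousDissipation.AnomalousDissipation.Theorems.SawtoothPulseCascade.SpectralLeakage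

variable {d : Type*} [Fintype d]

/-! ## The Young-type bound for a general kernel -/

/-- **Young-type bound with a kernel.**  For `F : T^d → ℂ` continuous, an absolutely summable coefficient family `c`
(of a multiplier `Θ`), and a kernel `K(k, q)` with `‖K(k,q)‖ ≤ L ρ(q)` wherever `c q ≠ 0` (`ρ ≥ 0`, `Σ ρ|c| < ∞`):
the family `R(k) = Σ_q c(q) K(k,q) 𝓕F(k−q)` is square-summable with `√(Σₖ‖R k‖²) ≤ L (Σ_q ρ(q)‖c q‖) √∫‖F‖²`
(pointwise weighted Cauchy–Schwarz and the shifted Tonelli identity, as in g0's `sqrt_tsum_sq_commutator_le`).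
[cite: Grafakos2014, Prop. 3.2.7 (3)] -/
theorem sqrt_tsum_sq_kernel_le {F : UnitAddTorus d → ℂ} (hF : Continuous F)
    (hFs : Summable fun k => ‖mFourierCoeff F k‖) {c : (d → ℤ) → ℂ}
    (K : (d → ℤ) → (d → ℤ) → ℂ) {ρ : (d → ℤ) → ℝ} {L : ℝ} (hρ0 : ∀ q, 0 ≤ ρ q) (hL : 0 ≤ L)
    (hK : ∀ k q, c q ≠ 0 → ‖K k q‖ ≤ L * ρ q) (hρs : Summable fun q => ρ q * ‖c q‖) :
    (∀ k, Summable fun q => c q * (K k q * mFourierCoeff F (k - q))) ∧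
    (Summable fun k => ‖∑' q, c q * (K k q * mFourierCoeff F (k - q))‖ ^ 2) ∧
    Real.sqrt (∑' k, ‖∑' q, c q * (K k q * mFourierCoeff F (k - q))‖ ^ 2) ≤
      L * (∑' q, ρ q * ‖c q‖) * Real.sqrt (∫ x, ‖F x‖ ^ 2) := by
  classical
  set f : (d → ℤ) → ℂ := mFourierCoeff F with hf_def
  have hB1 : ∀ j, ‖f j‖ ≤ ∑' i, ‖f i‖ := norm_le_tsum_norm hFs
  set B₁ : ℝ := ∑' i, ‖f i‖ with hB₁_def
  -- the pointwise bound `‖c q K(k,q) f(k-q)‖ ≤ L ρ q ‖c q‖ ‖f (k-q)‖`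
  have hpt : ∀ k q, ‖c q * (K k q * f (k - q))‖ ≤ L * (ρ q * ‖c q‖) * ‖f (k - q)‖ := by
    intro k q
    by_cases hq : c q = 0
    · simp [hq]
    · rw [norm_mul, norm_mul]
      calc ‖c q‖ * (‖K k q‖ * ‖f (k - q)‖) ≤ ‖c q‖ * (L * ρ q * ‖f (k - q)‖) :=
            mul_le_mul_of_nonneg_left (mul_le_mul_of_nonneg_right (hK k q hq) (norm_nonneg _)) (norm_nonneg _)
        _ = L * (ρ q * ‖c q‖) * ‖f (k - q)‖ := by ring
  have hsR : ∀ k, Summable fun q => c q * (K k q * f (k - q)) := fun k =>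
    .of_norm <| ((hρs.mul_left L).mul_right B₁).of_nonneg_of_le (fun _ => norm_nonneg _) fun q =>
      (hpt k q).trans (mul_le_mul_of_nonneg_left (hB1 _) (mul_nonneg hL (mul_nonneg (hρ0 q) (norm_nonneg _))))
  refine ⟨hsR, ?_⟩
  set R : (d → ℤ) → ℂ := fun k => ∑' q, c q * (K k q * f (k - q)) with hR_def
  -- Parseval for `F` and the shifted Tonelli identity
  have hParsF := hasSum_sq_mFourierCoeff_of_continuous hF
  set A : ℝ := ∑' q, ρ q * ‖c q‖ with hA_def
  have hA0 : 0 ≤ A := tsum_nonneg fun q => mul_nonneg (hρ0 q) (norm_nonneg _)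
  obtain ⟨hTon1, hTon2, hTon3⟩ := tsum_tsum_mul_shift (a := fun q => ρ q * ‖c q‖) (φ := fun k => ‖f k‖ ^ 2)
    (fun q => mul_nonneg (hρ0 q) (norm_nonneg _)) (fun k => sq_nonneg _) hρs hParsF.summable
  -- pointwise weighted Cauchy–Schwarz
  have hR_pt : ∀ k, ‖R k‖ ^ 2 ≤ L ^ 2 * (A * ∑' q, ρ q * ‖c q‖ * ‖f (k - q)‖ ^ 2) := fun k => by
    have hr0 : ∀ q, 0 ≤ ρ q * ‖c q‖ * ‖f (k - q)‖ := fun q =>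
      mul_nonneg (mul_nonneg (hρ0 q) (norm_nonneg _)) (norm_nonneg _)
    have hCS := tsum_sq_le_tsum_mul_tsum (r := fun q => ρ q * ‖c q‖ * ‖f (k - q)‖)
      (f := fun q => ρ q * ‖c q‖) (g := fun q => ρ q * ‖c q‖ * ‖f (k - q)‖ ^ 2) hr0
      (fun q => mul_nonneg (hρ0 q) (norm_nonneg _)) (fun q => mul_nonneg (mul_nonneg (hρ0 q) (norm_nonneg _))
        (sq_nonneg _)) hρs (hTon1 k) (fun q => le_of_eq (by ring))
    have hRle : ‖R k‖ ≤ L * ∑' q, ρ q * ‖c q‖ * ‖f (k - q)‖ := by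
      rw [hR_def, ← tsum_mul_left]
      refine (norm_tsum_le_tsum_norm (hsR k).norm).trans ?_
      refine (hsR k).norm.tsum_le_tsum (fun q => ?_) (hCS.1.mul_left L)
      calc ‖c q * (K k q * f (k - q))‖ ≤ L * (ρ q * ‖c q‖) * ‖f (k - q)‖ := hpt k q
        _ = L * (ρ q * ‖c q‖ * ‖f (k - q)‖) := by ring
    have h0 : 0 ≤ ∑' q, ρ q * ‖c q‖ * ‖f (k - q)‖ := tsum_nonneg hr0
    calc ‖R k‖ ^ 2 ≤ (L * ∑' q, ρ q * ‖c q‖ * ‖f (k - q)‖) ^ 2 := pow_le_pow_left₀ (norm_nonneg _) hRle 2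
      _ = L ^ 2 * (∑' q, ρ q * ‖c q‖ * ‖f (k - q)‖) ^ 2 := by ring
      _ ≤ L ^ 2 * (A * ∑' q, ρ q * ‖c q‖ * ‖f (k - q)‖ ^ 2) := mul_le_mul_of_nonneg_left hCS.2 (sq_nonneg _)
  have hRs : Summable fun k => ‖R k‖ ^ 2 :=
    ((hTon2.mul_left A).mul_left (L ^ 2)).of_nonneg_of_le (fun _ => sq_nonneg _) hR_pt
  have hR_le : ∑' k, ‖R k‖ ^ 2 ≤ (L * A) ^ 2 * ∫ x, ‖F x‖ ^ 2 :=
    calc ∑' k, ‖R k‖ ^ 2 ≤ ∑' k, L ^ 2 * (A * ∑' q, ρ q * ‖c q‖ * ‖f (k - q)‖ ^ 2) :=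
          hRs.tsum_le_tsum hR_pt ((hTon2.mul_left A).mul_left (L ^ 2))
      _ = L ^ 2 * (A * (A * ∑' k, ‖f k‖ ^ 2)) := by rw [tsum_mul_left, tsum_mul_left, hTon3]
      _ = (L * A) ^ 2 * ∫ x, ‖F x‖ ^ 2 := by rw [hParsF.tsum_eq]; ring
  refine ⟨hRs, ?_⟩
  calc Real.sqrt (∑' k, ‖R k‖ ^ 2) ≤ Real.sqrt ((L * A) ^ 2 * ∫ x, ‖F x‖ ^ 2) := Real.sqrt_le_sqrt hR_le
    _ = L * A * Real.sqrt (∫ x, ‖F x‖ ^ 2) := by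
        rw [Real.sqrt_mul' _ (integral_nonneg fun x => by positivity), Real.sqrt_sq (mul_nonneg hL hA0)]

/-! ## The expansion identity -/

/-- **The symbolic expansion of `m(D)(Θ·F)` to order `r`, as an identity of coefficients.**  With derivative multipliers
`Θ_α` (`𝓕Θ_α(q) = (2πi q_j)^α 𝓕Θ(q)`) and bounded derivative symbols `m_α`, for every mode `k`:
`m(k)·𝓕(ΘF)(k) − Σ_{α<r} 𝓕(Θ_α · m_α(D)F)(k) = Σ_q 𝓕Θ(q) · (m(k) − Σ_{α<r} (2πi q_j)^α m_α(k−q)) · 𝓕F(k−q)`,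
where `m_α(D)F` is the Fourier synthesis of `m_α · 𝓕F`. [cite: Grafakos2014, Prop. 3.1.2 (5)] -/
theorem symbol_mul_product_expansion {F Θ : UnitAddTorus d → ℂ} (hF : Continuous F)
    (hFs : Summable fun k => ‖mFourierCoeff F k‖) (hΘ : Continuous Θ) (hΘs : Summable fun q => ‖mFourierCoeff Θ q‖)
    (j : d) (r : ℕ) {Θd : ℕ → UnitAddTorus d → ℂ} (hΘd_c : ∀ α ∈ Finset.range r, Continuous (Θd α))
    (hΘd_s : ∀ α ∈ Finset.range r, Summable fun q => ‖mFourierCoeff (Θd α) q‖)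
    (hΘd : ∀ α ∈ Finset.range r, ∀ q, mFourierCoeff (Θd α) q = (2 * Real.pi * I * (q j : ℂ)) ^ α * mFourierCoeff Θ q)
    (m : (d → ℤ) → ℝ) {md : ℕ → (d → ℤ) → ℂ} {Md : ℝ} (hMd : ∀ α ∈ Finset.range r, ∀ k, ‖md α k‖ ≤ Md)
    (k : d → ℤ) :
    (m k : ℂ) * mFourierCoeff (fun x => Θ x * F x) k -
        ∑ α ∈ Finset.range r, mFourierCoeff (fun x => Θd α x *
          fourierSynth (fun k => md α k * mFourierCoeff F k) x) k =
      ∑' q, mFourierCoeff Θ q * (((m k : ℂ) - ∑ α ∈ Finset.range r, (2 * Real.pi * I * (q j : ℂ)) ^ α * md α (k - q)) *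
        mFourierCoeff F (k - q)) := by
  classical
  set f : (d → ℤ) → ℂ := mFourierCoeff F with hf_def
  set c : (d → ℤ) → ℂ := mFourierCoeff Θ with hc_def
  have hB1 : ∀ j, ‖f j‖ ≤ ∑' i, ‖f i‖ := norm_le_tsum_norm hFs
  set B₁ : ℝ := ∑' i, ‖f i‖ with hB₁_def
  -- the syntheses `m_α(D)F`
  have hh : ∀ α ∈ Finset.range r, Summable fun k => ‖md α k * f k‖ := fun α hα =>
    (hFs.mul_left Md).of_nonneg_of_le (fun _ => norm_nonneg _) fun k => by
      rw [norm_mul]; exact mul_le_mul_of_nonneg_right (hMd α hα k) (norm_nonneg _)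
  have hH_c : ∀ α ∈ Finset.range r, Continuous (fourierSynth fun k => md α k * f k) := fun α hα =>
    continuous_fourierSynth (hh α hα)
  have hH_coeff : ∀ α ∈ Finset.range r, ∀ k, mFourierCoeff (fourierSynth fun k => md α k * f k) k = md α k * f k :=
    fun α hα => mFourierCoeff_fourierSynth (hh α hα)
  -- product coefficients
  have hprod : mFourierCoeff (fun x => Θ x * F x) k = ∑' q, c q * f (k - q) := by
    rw [ScalarFourier.mFourierCoeff_mul hΘ hΘs hF k, lconv_apply]
  have hP : ∀ α ∈ Finset.range r, mFourierCoeff (fun x => Θd α x * fourierSynth (fun k => md α k * f k) x) k =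
      ∑' q, c q * ((2 * Real.pi * I * (q j : ℂ)) ^ α * (md α (k - q) * f (k - q))) := by
    intro α hα
    rw [ScalarFourier.mFourierCoeff_mul (hΘd_c α hα) (hΘd_s α hα) (hH_c α hα) k, lconv_apply]
    refine tsum_congr fun q => ?_
    rw [hH_coeff α hα, hΘd α hα q, hc_def]
    ring
  -- summability of the pieces
  have hsP : ∀ α ∈ Finset.range r, Summable fun q => c q * ((2 * Real.pi * I * (q j : ℂ)) ^ α * (md α (k - q) * f (k - q))) := by
    intro α hα
    refine .of_norm <| ((hΘd_s α hα).mul_right (Md * B₁)).of_nonneg_of_le (fun _ => norm_nonneg _) fun q => ?_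
    rw [hΘd α hα q, norm_mul, norm_mul, norm_mul, norm_mul]
    have h1 : ‖md α (k - q)‖ * ‖f (k - q)‖ ≤ Md * B₁ :=
      mul_le_mul (hMd α hα _) (hB1 _) (norm_nonneg _) ((norm_nonneg _).trans (hMd α hα 0))
    calc ‖c q‖ * (‖(2 * Real.pi * I * (q j : ℂ)) ^ α‖ * (‖md α (k - q)‖ * ‖f (k - q)‖))
        ≤ ‖c q‖ * (‖(2 * Real.pi * I * (q j : ℂ)) ^ α‖ * (Md * B₁)) :=
          mul_le_mul_of_nonneg_left (mul_le_mul_of_nonneg_left h1 (norm_nonneg _)) (norm_nonneg _)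
      _ = ‖(2 * Real.pi * I * (q j : ℂ)) ^ α‖ * ‖mFourierCoeff Θ q‖ * (Md * B₁) := by rw [hc_def]; ring
  have hs1 : Summable fun q => (m k : ℂ) * (c q * f (k - q)) :=
    Summable.mul_left _ <| .of_norm <| (hΘs.mul_right B₁).of_nonneg_of_le (fun _ => norm_nonneg _) fun q => by
      rw [norm_mul]; exact mul_le_mul_of_nonneg_left (hB1 _) (norm_nonneg _)
  have hsum : ∑ α ∈ Finset.range r, mFourierCoeff (fun x => Θd α x * fourierSynth (fun k => md α k * f k) x) k =
      ∑' q, ∑ α ∈ Finset.range r, c q * ((2 * Real.pi * I * (q j : ℂ)) ^ α * (md α (k - q) * f (k - q))) := by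
    rw [Finset.sum_congr rfl hP]
    exact (Summable.tsum_finsetSum hsP).symm
  have hsS : Summable fun q => ∑ α ∈ Finset.range r, c q * ((2 * Real.pi * I * (q j : ℂ)) ^ α * (md α (k - q) * f (k - q))) :=
    summable_sum fun α hα => hsP α hα
  rw [hprod, hsum, ← tsum_mul_left, ← hs1.tsum_sub hsS]
  refine tsum_congr fun q => ?_
  have hre : ∑ α ∈ Finset.range r, c q * ((2 * Real.pi * I * (q j : ℂ)) ^ α * (md α (k - q) * f (k - q))) =
      c q * ((∑ α ∈ Finset.range r, (2 * Real.pi * I * (q j : ℂ)) ^ α * md α (k - q)) * f (k - q)) := by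
    rw [Finset.sum_mul, Finset.mul_sum]
    exact Finset.sum_congr rfl fun α _ => by ring
  rw [hre]
  ring

/-! ## The energy bound -/

/-- **The higher-order bound for `‖m(D)(Θ·F)‖`.**  Under the expansion data of `symbol_mul_product_expansion`, sup bounds
`‖Θ_α‖ ≤ B_α` and the discrete Taylor remainder `‖m(k) − Σ_{α<r}(2πi q_j)^α m_α(k−q)‖ ≤ L ρ(q)` on the spectrum of `Θ`
(`ρ ≥ 0`, `Σ ρ|𝓕Θ| < ∞`):
`√(Σₖ m_k² ‖𝓕(ΘF)(k)‖²) ≤ Σ_{α<r} B_α √(Σₖ ‖m_α(k)‖² ‖𝓕F(k)‖²) + L (Σ_q ρ(q)‖𝓕Θ(q)‖) √∫‖F‖²`.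
With `Θ_0 = Θ`, `B_0 = 1`, `m_0 = m` the first term is `‖m(D)F‖`; the terms `1 ≤ α < r` cost `B_α sup|m_α| ‖F‖`.
(The case `r = 1` is g0's `sqrt_tsum_symbol_sq_mul_le`.) [cite: Grafakos2014, Prop. 3.1.2 (5) and Prop. 3.2.7 (3)] -/
theorem sqrt_tsum_symbol_sq_mul_le_of_expansion {F Θ : UnitAddTorus d → ℂ} (hF : Continuous F)
    (hFs : Summable fun k => ‖mFourierCoeff F k‖) (hΘ : Continuous Θ) (hΘs : Summable fun q => ‖mFourierCoeff Θ q‖)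
    (j : d) (r : ℕ) {Θd : ℕ → UnitAddTorus d → ℂ} (hΘd_c : ∀ α ∈ Finset.range r, Continuous (Θd α))
    (hΘd_s : ∀ α ∈ Finset.range r, Summable fun q => ‖mFourierCoeff (Θd α) q‖)
    (hΘd : ∀ α ∈ Finset.range r, ∀ q, mFourierCoeff (Θd α) q = (2 * Real.pi * I * (q j : ℂ)) ^ α * mFourierCoeff Θ q)
    {B : ℕ → ℝ} (hB : ∀ α ∈ Finset.range r, ∀ x, ‖Θd α x‖ ≤ B α)
    {m : (d → ℤ) → ℝ} {md : ℕ → (d → ℤ) → ℂ} {Md : ℝ}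
    (hMd : ∀ α ∈ Finset.range r, ∀ k, ‖md α k‖ ≤ Md) {ρ : (d → ℤ) → ℝ} {L : ℝ} (hρ0 : ∀ q, 0 ≤ ρ q) (hL : 0 ≤ L)
    (hT : ∀ k q, mFourierCoeff Θ q ≠ 0 →
      ‖(m k : ℂ) - ∑ α ∈ Finset.range r, (2 * Real.pi * I * (q j : ℂ)) ^ α * md α (k - q)‖ ≤ L * ρ q)
    (hρs : Summable fun q => ρ q * ‖mFourierCoeff Θ q‖) :
    Real.sqrt (∑' k, m k ^ 2 * ‖mFourierCoeff (fun x => Θ x * F x) k‖ ^ 2) ≤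
      ∑ α ∈ Finset.range r, B α * Real.sqrt (∑' k, ‖md α k‖ ^ 2 * ‖mFourierCoeff F k‖ ^ 2) +
        L * (∑' q, ρ q * ‖mFourierCoeff Θ q‖) * Real.sqrt (∫ x, ‖F x‖ ^ 2) := by
  classical
  -- the remainder family and its bound
  obtain ⟨_, hRs, hR⟩ := sqrt_tsum_sq_kernel_le hF hFs (c := mFourierCoeff Θ)
    (fun k q => (m k : ℂ) - ∑ α ∈ Finset.range r, (2 * Real.pi * I * (q j : ℂ)) ^ α * md α (k - q)) hρ0 hL hT hρs
  set f : (d → ℤ) → ℂ := mFourierCoeff F with hf_def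
  have hB0 : ∀ α ∈ Finset.range r, 0 ≤ B α := fun α hα => (norm_nonneg _).trans (hB α hα 0)
  set R : (d → ℤ) → ℂ := fun k => ∑' q, mFourierCoeff Θ q *
    (((m k : ℂ) - ∑ α ∈ Finset.range r, (2 * Real.pi * I * (q j : ℂ)) ^ α * md α (k - q)) * f (k - q)) with hR_def
  -- the pieces `P_α = Θ_α · m_α(D)F` and their `L²` norms
  have hh : ∀ α ∈ Finset.range r, Summable fun k => ‖md α k * f k‖ := fun α hα =>
    (hFs.mul_left Md).of_nonneg_of_le (fun _ => norm_nonneg _) fun k => by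
      rw [norm_mul]; exact mul_le_mul_of_nonneg_right (hMd α hα k) (norm_nonneg _)
  have hH_c : ∀ α ∈ Finset.range r, Continuous (fourierSynth fun k => md α k * f k) := fun α hα =>
    continuous_fourierSynth (hh α hα)
  have hH_coeff : ∀ α ∈ Finset.range r, ∀ k, mFourierCoeff (fourierSynth fun k => md α k * f k) k = md α k * f k :=
    fun α hα => mFourierCoeff_fourierSynth (hh α hα)
  set Pc : ℕ → (d → ℤ) → ℂ := fun α k => mFourierCoeff (fun x => Θd α x * fourierSynth (fun k => md α k * f k) x) k
    with hPc_def
  have hP_c : ∀ α ∈ Finset.range r, Continuous (fun x => Θd α x * fourierSynth (fun k => md α k * f k) x) :=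
    fun α hα => (hΘd_c α hα).mul (hH_c α hα)
  have hPars : ∀ α ∈ Finset.range r, HasSum (fun k => ‖Pc α k‖ ^ 2)
      (∫ x, ‖Θd α x * fourierSynth (fun k => md α k * f k) x‖ ^ 2) := fun α hα =>
    hasSum_sq_mFourierCoeff_of_continuous (hP_c α hα)
  have hParsH : ∀ α ∈ Finset.range r, HasSum (fun k => ‖md α k * f k‖ ^ 2)
      (∫ x, ‖fourierSynth (fun k => md α k * f k) x‖ ^ 2) := fun α hα => by
    have h := hasSum_sq_mFourierCoeff_of_continuous (hH_c α hα)
    simp_rw [hH_coeff α hα] at h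
    exact h
  -- `‖P_α‖ ≤ B_α ‖m_α(D)F‖`
  have hPle : ∀ α ∈ Finset.range r, Real.sqrt (∑' k, ‖Pc α k‖ ^ 2) ≤
      B α * Real.sqrt (∑' k, ‖md α k‖ ^ 2 * ‖f k‖ ^ 2) := by
    intro α hα
    rw [(hPars α hα).tsum_eq]
    have h1 : ∫ x, ‖Θd α x * fourierSynth (fun k => md α k * f k) x‖ ^ 2 ≤
        B α ^ 2 * ∫ x, ‖fourierSynth (fun k => md α k * f k) x‖ ^ 2 :=
      integral_norm_sq_mul_le (hH_c α hα) (hB α hα)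
    have h2 : ∫ x, ‖fourierSynth (fun k => md α k * f k) x‖ ^ 2 = ∑' k, ‖md α k‖ ^ 2 * ‖f k‖ ^ 2 := by
      rw [← (hParsH α hα).tsum_eq]; exact tsum_congr fun k => by rw [norm_mul, mul_pow]
    calc Real.sqrt (∫ x, ‖Θd α x * fourierSynth (fun k => md α k * f k) x‖ ^ 2)
        ≤ Real.sqrt (B α ^ 2 * ∫ x, ‖fourierSynth (fun k => md α k * f k) x‖ ^ 2) := Real.sqrt_le_sqrt h1
      _ = B α * Real.sqrt (∑' k, ‖md α k‖ ^ 2 * ‖f k‖ ^ 2) := by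
          rw [Real.sqrt_mul' _ (integral_nonneg fun x => by positivity), Real.sqrt_sq (hB0 α hα), h2]
  -- the identity `m k 𝓕(ΘF) k = Σ_α P_α k + R k`
  have hid : ∀ k, (m k : ℂ) * mFourierCoeff (fun x => Θ x * F x) k = ∑ α ∈ Finset.range r, Pc α k + R k := by
    intro k
    have h := symbol_mul_product_expansion hF hFs hΘ hΘs j r hΘd_c hΘd_s hΘd m hMd k
    rw [sub_eq_iff_eq_add'] at h
    rw [h]
  -- Minkowski in `ℓ²`
  have hsq : ∀ k, m k ^ 2 * ‖mFourierCoeff (fun x => Θ x * F x) k‖ ^ 2 =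
      ‖(m k : ℂ) * mFourierCoeff (fun x => Θ x * F x) k‖ ^ 2 := fun k => by
    rw [norm_mul, Complex.norm_real, Real.norm_eq_abs, mul_pow, sq_abs]
  simp_rw [hsq, hid]
  have hPs : ∀ α ∈ Finset.range r, Summable fun k => ‖Pc α k‖ ^ 2 := fun α hα => (hPars α hα).summable
  -- `√Σ‖Σ_α P_α + R‖² ≤ Σ_α √Σ‖P_α‖² + √Σ‖R‖²`
  have hMink : ∀ (s : Finset ℕ), (∀ α ∈ s, Summable fun k => ‖Pc α k‖ ^ 2) →
      (Summable fun k => ‖∑ α ∈ s, Pc α k + R k‖ ^ 2) ∧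
      Real.sqrt (∑' k, ‖∑ α ∈ s, Pc α k + R k‖ ^ 2) ≤
        ∑ α ∈ s, Real.sqrt (∑' k, ‖Pc α k‖ ^ 2) + Real.sqrt (∑' k, ‖R k‖ ^ 2) := by
    intro s hs
    induction s using Finset.induction_on with
    | empty => exact ⟨by simpa using hRs, by simp⟩
    | @insert a s ha ih =>
      obtain ⟨ih1, ih2⟩ := ih fun α hα => hs α (Finset.mem_insert_of_mem hα)
      have hPa := hs a (Finset.mem_insert_self a s)
      have hM := Real.Lp_add_le_tsum_of_nonneg (p := 2) (f := fun k => ‖Pc a k‖) (g := fun k => ‖∑ α ∈ s, Pc α k + R k‖)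
        (by norm_num) (fun k => norm_nonneg _) (fun k => norm_nonneg _)
        (by simpa using hPa) (by simpa using ih1)
      simp only [Real.rpow_two] at hM
      obtain ⟨hM1, hM2⟩ := hM
      have hptle : ∀ k, ‖∑ α ∈ insert a s, Pc α k + R k‖ ^ 2 ≤ (‖Pc a k‖ + ‖∑ α ∈ s, Pc α k + R k‖) ^ 2 := fun k => by
        rw [Finset.sum_insert ha, add_assoc]
        exact pow_le_pow_left₀ (norm_nonneg _) (norm_add_le _ _) 2
      have hS : Summable fun k => ‖∑ α ∈ insert a s, Pc α k + R k‖ ^ 2 :=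
        hM1.of_nonneg_of_le (fun k => sq_nonneg _) hptle
      refine ⟨hS, ?_⟩
      rw [Finset.sum_insert ha]
      have h1 : Real.sqrt (∑' k, ‖∑ α ∈ insert a s, Pc α k + R k‖ ^ 2) ≤
          Real.sqrt (∑' k, (‖Pc a k‖ + ‖∑ α ∈ s, Pc α k + R k‖) ^ 2) :=
        Real.sqrt_le_sqrt (hS.tsum_le_tsum hptle hM1)
      have h2 : Real.sqrt (∑' k, (‖Pc a k‖ + ‖∑ α ∈ s, Pc α k + R k‖) ^ 2) ≤
          Real.sqrt (∑' k, ‖Pc a k‖ ^ 2) + Real.sqrt (∑' k, ‖∑ α ∈ s, Pc α k + R k‖ ^ 2) := by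
        have := hM2
        simp only [one_div] at this
        rwa [Real.sqrt_eq_rpow, Real.sqrt_eq_rpow, Real.sqrt_eq_rpow]
      linarith
  obtain ⟨_, hfin⟩ := hMink (Finset.range r) hPs
  refine hfin.trans (add_le_add (Finset.sum_le_sum hPle) ?_)
  exact hR

end Summit.AnomalousDissipation.AnomalousDissipation.Theorems.SawtoothPulseCascade.K1Slot
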